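import Summits.Ventures.PercRepro.RankDistEarsWitness
import Summits.Ventures.PercRepro.RankDistBottomCumulative

/-!
# PercRepro — `C₄ + ears`: THE BOTTOM COUNT AS A KERNEL SUM; (BC) AND C-025 HOLD ON THE CONNECTED WITNESS (p9, gen 24)

The bottom sets of `C₄ + ears` (`mem_Uq_ears`) are counted like the shadow levels (`card_shadowLev_ears`): a bottom
pattern is read off the host edges `X` and the host types, so `#𝓑 = bottomSum k := Σ_X Σ_T [bottomCond X T] ·
Π_j hostCount (k j) (T j)` (`card_Uq_ears`), evaluated by the kernel — on the witness `kWit = (1, 6, 6, 6)`: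
`#𝓑 = 50,069,504` (`= 2^19·4 + 3·19·2^18 + 126·2^17`, g23's profiler). With `s_20 = 49,712,682,990`,
`s_21 = 51,284,660,589`, `s_22 = 16,778,485,077` this gives, IN THE KERNEL, on the very cell where the row (SC) fails
(`not_shadowCumulative_ears`): the repaired row (BC) `bottomCumulativeTop_kWit : BottomCumulativeTop (ears kWit) 22 20`
(with slack `≈ 1000` at every level) and the crux `rls_kWit : ThmN.RLS (ears kWit) 22 20` — as g23 did for the direct
sum `B_11 ⊕ B_12` (`rls_bookSum'`). The general fibration `card_filter_pattern_eq_sum` (any Boolean condition on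
`(X, host types)`) is recorded here; `levelSum` is its instance. Nothing here moves any window of the crux.
-/

namespace PercRepro.RankDist

open Set Finset _root_.Matroid PercRepro.ThmH

variable {k : Fin 4 → ℕ}

/-- **The fibration over host types, for any Boolean condition** on the host edges and the host types. -/
theorem card_filter_pattern_eq_sum (c : Finset (Fin 4) → (Fin 4 → Bool × Bool) → Bool) :
    ((Finset.univ : Finset (Finset (Fin 4) × (Ear k → Finset Bool))).filter
      (fun x => (∀ j, hostMiss k x.2 j ≤ 1) ∧ c x.1 (hostType k x.2) = true)).card
      = ∑ X : Finset (Fin 4), ∑ T : Fin 4 → Bool × Bool,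
          (if c X T then ∏ j, hostCount (k j) (T j) else 0) := by
  classical
  rw [Finset.card_eq_sum_ones, Finset.sum_filter, Fintype.sum_prod_type]
  refine Finset.sum_congr rfl (fun X _ => ?_)
  rw [← Finset.sum_filter, ← Finset.card_eq_sum_ones,
    Finset.card_eq_sum_card_fiberwise (f := hostType k) (t := Finset.univ) (fun _ _ => Finset.mem_univ _)]
  refine Finset.sum_congr rfl (fun T _ => ?_)
  rw [Finset.filter_filter]
  split_ifs with hT
  · rw [← card_fiber_hostType T]
    congr 1
    apply Finset.filter_congr
    intro g _
    constructor
    · rintro ⟨⟨h1, -⟩, h2⟩; exact ⟨h1, h2⟩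
    · rintro ⟨h1, h2⟩; exact ⟨⟨h1, by rw [h2]; exact hT⟩, h2⟩
  · rw [Finset.card_eq_zero, Finset.filter_eq_empty_iff]
    rintro g - ⟨⟨-, h⟩, h2⟩
    rw [h2] at h
    exact hT h

/-- **The bottom condition** on `(X, T)`: no host with a full ear, the hosts with a missed ear inside `X`,
`#X = #M + 1`, `#X ≤ 3`. -/
def bottomCond (X : Finset (Fin 4)) (T : Fin 4 → Bool × Bool) : Bool :=
  decide (∀ j, (T j).2 = false) && decide (typeM T ⊆ X) && decide (X.card = (typeM T).card + 1) &&
    decide (X.card ≤ 3)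

/-- **The bottom sum**: the number of bottom sets of `C₄ + ears`, as a sum over host edges and host types. -/
def bottomSum (k : Fin 4 → ℕ) : ℕ :=
  ∑ X : Finset (Fin 4), ∑ T : Fin 4 → Bool × Bool, (if bottomCond X T then ∏ j, hostCount (k j) (T j) else 0)

/-- A bottom pattern is the bottom condition on the host type. -/
lemma bottomPat_iff_bottomCond (X : Finset (Fin 4)) (g : Ear k → Finset Bool) :
    BottomPat k X g ↔ ((∀ j, hostMiss k g j ≤ 1) ∧ bottomCond X (hostType k g) = true) := by
  unfold BottomPat bottomCond
  simp only [Bool.and_eq_true, decide_eq_true_eq, hostType, hostFull, decide_eq_false_iff_not, not_exists,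
    not_and]
  constructor
  · rintro ⟨hnf, hle1, hsub, hcard, h3⟩
    exact ⟨hle1, ⟨⟨⟨fun j i _ => hnf i, hsub⟩, hcard⟩, h3⟩⟩
  · rintro ⟨hle1, ⟨⟨⟨hnf, hsub⟩, hcard⟩, h3⟩⟩
    exact ⟨fun i => hnf i.1 i rfl, hle1, hsub, hcard, h3⟩

/-- **The bottom sets of `C₄ + ears` are counted by the bottom sum**: `#𝓑 = bottomSum k` on the tight layer
`(K + 3, K + 1)`. -/
theorem card_Uq_ears :
    (PerFlat.Uq (ears k) (∑ j, k j + 3) (∑ j, k j + 1)).card = bottomSum k := by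
  classical
  have h1 : (PerFlat.Uq (ears k) (∑ j, k j + 3) (∑ j, k j + 1)).card
      = ((Finset.univ : Finset (Finset (Fin 4) × (Ear k → Finset Bool))).filter
          (fun x => (∀ j, hostMiss k x.2 j ≤ 1) ∧ bottomCond x.1 (hostType k x.2) = true)).card := by
    refine Finset.card_nbij' (fun B => (patX k (B : Set (Gr k)), patG k (B : Set (Gr k))))
      (fun x => (gr (ears k)).filter (fun e => e ∈ earsOf k x.1 x.2)) ?_ ?_ ?_ ?_
    · intro B hB
      rw [Finset.mem_coe] at hB
      rw [Finset.mem_coe, Finset.mem_filter]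
      exact ⟨Finset.mem_univ _, (bottomPat_iff_bottomCond _ _).1 ((mem_Uq_ears B).1 hB)⟩
    · intro x hx
      rw [Finset.mem_coe, Finset.mem_filter] at hx
      rw [Finset.mem_coe, mem_Uq_ears, coe_filter_mem_gr (ears k) (by simp only [ears_ground, Set.subset_univ]),
        patX_earsOf, patG_earsOf]
      exact (bottomPat_iff_bottomCond _ _).2 hx.2
    · intro B _
      apply Finset.coe_injective
      rw [coe_filter_mem_gr (ears k) (by simp only [ears_ground, Set.subset_univ]), earsOf_pat]
    · intro x _
      show (patX k ((((gr (ears k)).filter (fun e => e ∈ earsOf k x.1 x.2)) : Finset (Gr k)) : Set (Gr k)),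
        patG k ((((gr (ears k)).filter (fun e => e ∈ earsOf k x.1 x.2)) : Finset (Gr k)) : Set (Gr k))) = x
      rw [coe_filter_mem_gr (ears k) (by simp only [ears_ground, Set.subset_univ]), patX_earsOf, patG_earsOf]
  rw [h1, card_filter_pattern_eq_sum]
  rfl

/-! ## The witness: (BC) and C-025 hold where (SC) fails -/

/-- **`#𝓑 = 50,069,504`** on the witness (kernel evaluation of the bottom sum). -/
theorem bottomSum_kWit : bottomSum kWit = 50069504 := by
  set_option maxRecDepth 200000 in decide +kernel

/-- **`s_22 = 16,778,485,077`** on the witness (kernel evaluation of the level sum). -/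
theorem levelSum_kWit_22 : levelSum kWit 22 = 16778485077 := by
  set_option maxRecDepth 200000 in decide +kernel

/-- The bottom sets of the witness. -/
theorem card_Uq_kWit : (PerFlat.Uq (ears kWit) 22 20).card = 50069504 := by
  have h := card_Uq_ears (k := kWit)
  rw [sum_kWit] at h
  rw [h, bottomSum_kWit]

/-- The level-`22` shadow of the witness. -/
theorem card_shadowLev_kWit_22 :
    (shadowLev (ears kWit) 22 (PerFlat.Uq (ears kWit) 22 20)).card = 16778485077 := by
  have h := card_shadowLev_ears (k := kWit) 22
  rw [sum_kWit] at h
  rw [h, levelSum_kWit_22]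

/-- **THE REPAIRED ROW (BC) HOLDS ON THE CONNECTED WITNESS**: `BottomCumulativeTop (ears kWit) 22 20` — at the levels
`20, 21, 22` the inequalities read `#𝓑 ≤ s_20`, `22·#𝓑 ≤ 21·s_21`, `#𝓑 ≤ s_22`. -/
theorem bottomCumulativeTop_kWit : BottomCumulativeTop (ears kWit) 22 20 := by
  intro v hqv hvp
  rw [card_Uq_kWit]
  have hpos : 0 < Nat.choose 42 20 := Nat.choose_pos (by norm_num)
  have hc : Nat.choose 42 21 * 21 = Nat.choose 42 20 * 22 := by
    have := Nat.choose_succ_right_eq 42 20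
    simpa using this
  have hsym : Nat.choose 42 22 = Nat.choose 42 20 := by
    have := Nat.choose_symm_add (a := 22) (b := 20)
    simpa using this
  interval_cases v
  · rw [card_shadowLev_kWit_20]
    exact Nat.mul_le_mul_right _ (by norm_num)
  · rw [card_shadowLev_kWit_21]
    -- `50069504 · C(42,21) ≤ 51284660589 · C(42,20)`: multiply by `21` and use `hc`
    have h21 : 50069504 * Nat.choose 42 21 * 21 ≤ 51284660589 * Nat.choose 42 20 * 21 := by
      calc 50069504 * Nat.choose 42 21 * 21 = 50069504 * (Nat.choose 42 21 * 21) := by ring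
        _ = 50069504 * (Nat.choose 42 20 * 22) := by rw [hc]
        _ = (50069504 * 22) * Nat.choose 42 20 := by ring
        _ ≤ (51284660589 * 21) * Nat.choose 42 20 := Nat.mul_le_mul_right _ (by norm_num)
        _ = 51284660589 * Nat.choose 42 20 * 21 := by ring
    exact Nat.le_of_mul_le_mul_right h21 (by norm_num)
  · rw [card_shadowLev_kWit_22, hsym]
    exact Nat.mul_le_mul_right _ (by norm_num)

/-- **C-025 HOLDS ON THE CONNECTED WITNESS**: `ThmN.RLS (ears kWit) 22 20` (through (BC); also Theorem M). -/
theorem rls_kWit : ThmN.RLS (ears kWit) 22 20 :=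
  rls_of_bottomCumulativeTop (ears kWit) 22 20 bottomCumulativeTop_kWit

end PercRepro.RankDist
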